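import Summits.RiemannHypothesis.RiemannHypothesis.Theorems.LiDirichletAsymptoticLawProof
import Literature.NumberTheory.LFunctions.LiCriterionDirichlet
import HarnessLib

/-!
# THE DIRICHLET SQUARE-ROOT LAG LAW for `Re λ_χ(n)` (part 1/2: the law; GRH-free at a verified height, effective under GRH(χ))

PRE-CUT (not filed): cell rh-split, seat rh-split-li-bridge g14 (brief sha16 f79c5f09d8bcb036), card
`run/shared/lean/pub/rh-split/cards/SPLIT-li-bridge.md` §21; kernel source `HOME/rh-split-li-bridge/SketchG14.lean`
sha16 725d0c5abc4b986a (486 l, 26 theorems, farm rc 0 · 0 err · 0 warn · 0 sorry, std axioms); cut by the seat into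
TWO files ≤ 400 l (this = part 1/2, SketchG14 §§1–3), decl text byte-verbatim; deltas = namespace, this header,
`set_option linter.dupNamespace false`.  A typer files it only after the referee's label line (cell rule).
Zero definitions; tree inputs cited, not re-derived.

`λ_χ(n) = LiDirichlet.liCoeffCharRe χ n` (`χ` primitive mod `q > 1`), `M_q(n) = charLiMainTerm q n = (n/2) log n + C₁ n
+ (n/2) log q`.  INPUT (tree, route `LiDirichletAsymptotic`, CLOSED·proved): `liDirichletAsymptoticLaw_proof` —
`LFunctionRHUpTo χ T`, `T ≥ 1000`, `n ≤ T²/4` ⟹ `|λ_χ(n) − M_q(n)| ≤ 15√n·log(qn)` (`n ≥ 10⁴`), `≤ √n·log(qn)` (`n ≥ 900`,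
given `bmor2021_theorem11`).  §1 elementary inequalities (SketchG13 §1).  §2 RH-FREE CORE WITH CONDUCTOR
`lag_lower_bound_cond` (any real sequence; an `A√n(L + log n)`-law at `m` and at `n ≥ m + c√m` gives
`a n − a m ≥ (n − m)((1/2 − 2A/c − A/(2s₀))(L + log n) + C₁)`).  §3 THE LAW: `liChar_sqrtLag_monotone_of_rhUpTo`
(`10⁴ ≤ m`, `m + 120√m ≤ n ≤ T²/4`; GRH-FREE), `…_bmor` (`900 ≤ m`, lag `7√m`), `liChar_sqrtLag_monotone_platt`
(`q ≤ 10⁵`, `n ≤ ¼(10⁸/q)²`, on `platt2016_theorem71`), `liChar_sqrtLag_monotone_of_grh` (`GRH(χ)` ⟹ all `m ≥ 10⁴`;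
EFFECTIVE, constants uniform in `q`), `liChar_lag_monotone_of_level_law` (an `A`-law gives every lag `c > 4A` with `m₀`
chosen BEFORE `q, χ`), `liChar_lag_monotone_of_grh_every_c` (every `c > 60`, `m₀` uniform in the conductor).
Part 2/2 (`LiDirichletLiConverse`) has the GRH-free bounded-below converse and the relabelling `GRH(χ) ⟺ lag law`.

HONEST LABEL: SPLITTING SEARCH over kernel-typed RH-EQUIVALENCES; a splitting A ∧ B ⟹ RH is CONDITIONAL
bookkeeping unless A and B are both proved; nothing here bears on the truth of RH.  Every theorem below is a
GRH(χ)-FREE implication, an inequality conditional on a named verified-height / explicit-bound fact carried as a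
hypothesis, a GRH(χ)-consequence (`χ.RiemannHypothesis → …`), or a GRH(χ)-equivalence labelled RELABELLING; none is
a claim about RH or GRH.
-/

set_option linter.dupNamespace false

namespace Summit.RiemannHypothesis.RiemannHypothesis.Theorems.Splittings.LiDirichletSqrtLagLaw

open scoped ComplexConjugate
open Literature.NumberTheory.LFunctions Literature.NumberTheory.LFunctions.ExplicitPsiChar
open Literature.NumberTheory.LFunctions.BombieriLagarias
open Summit.RiemannHypothesis.RiemannHypothesis.Theorems.LiTheory

/-! ## §1 Elementary inequalities (SketchG13 §1, rh-split-li-bridge g13) -/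

/-- `√(m + d) ≤ √m + d/(2√m)` (`m > 0`, `d ≥ 0`). -/
private theorem sqrt_add_le_sqrt_add_div {m d : ℝ} (hm : 0 < m) (hd : 0 ≤ d) :
    Real.sqrt (m + d) ≤ Real.sqrt m + d / (2 * Real.sqrt m) := by
  have hs : 0 < Real.sqrt m := Real.sqrt_pos.2 hm
  have hss : Real.sqrt m ^ 2 = m := Real.sq_sqrt hm.le
  have hst : 2 * Real.sqrt m * (d / (2 * Real.sqrt m)) = d := by field_simp
  have ht0 : 0 ≤ d / (2 * Real.sqrt m) := by positivity
  have hsq : m + d ≤ (Real.sqrt m + d / (2 * Real.sqrt m)) ^ 2 := by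
    nlinarith [sq_nonneg (d / (2 * Real.sqrt m))]
  calc Real.sqrt (m + d) ≤ Real.sqrt ((Real.sqrt m + d / (2 * Real.sqrt m)) ^ 2) := Real.sqrt_le_sqrt hsq
    _ = Real.sqrt m + d / (2 * Real.sqrt m) := Real.sqrt_sq (by positivity)

/-- `j · 0.6931471803 ≤ log x` whenever `2 ^ j ≤ x`. -/
private theorem mul_log_two_le_log {j : ℕ} {x : ℝ} (hx : (2 : ℝ) ^ j ≤ x) : (j : ℝ) * 0.6931471803 ≤ Real.log x := by
  have h2 : (0 : ℝ) < 2 ^ j := by positivity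
  have hlog : Real.log ((2 : ℝ) ^ j) ≤ Real.log x := Real.log_le_log h2 hx
  rw [Real.log_pow] at hlog
  have hl2 := Real.log_two_gt_d9
  have hj : (0 : ℝ) ≤ j := Nat.cast_nonneg j
  nlinarith [mul_le_mul_of_nonneg_left hl2.le hj]

/-- `C₁ = (γ − 1 − log 2π)/2 ≥ −5/4` (`γ > 1/2`, `log 2π ≤ 2` since `2π < e²`). -/
private theorem neg_five_fourths_le_liC1 : -(5 / 4 : ℝ) ≤ liC1 := by
  have hγ := Real.one_half_lt_eulerMascheroniConstant
  have hπ := Real.pi_lt_d2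
  have he := Real.exp_one_gt_d9
  have h2 : Real.log (2 * Real.pi) ≤ 2 := by
    rw [Real.log_le_iff_le_exp (by positivity)]
    have hexp : Real.exp 2 = Real.exp 1 * Real.exp 1 := by rw [← Real.exp_add]; norm_num
    rw [hexp]; nlinarith
  unfold liC1
  linarith

/-- `s₀ ≤ √m` from `s₀² ≤ m` (`s₀ ≥ 0`). -/
private theorem le_sqrt_of_sq_le {s₀ : ℝ} {m : ℝ} (hs₀ : 0 ≤ s₀) (h : s₀ ^ 2 ≤ m) : s₀ ≤ Real.sqrt m := by
  calc s₀ = Real.sqrt (s₀ ^ 2) := (Real.sqrt_sq hs₀).symm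
    _ ≤ Real.sqrt m := Real.sqrt_le_sqrt h

/-! ## §2 The RH-free core with conductor -/

/-- **RH/GRH-FREE CORE (pure real analysis, any real sequence `a`, any `L ≥ 0`).**  If
`|a m − (M(m) + (m/2)L)| ≤ A√m(L + log m)` and `|a n − (M(n) + (n/2)L)| ≤ A√n(L + log n)` with `1 ≤ m`,
`0 < s₀ ≤ √m`, `0 < c`, `m + c√m ≤ n`, then `(n − m)((1/2 − 2A/c − A/(2s₀))(L + log n) + C₁) ≤ a n − a m`.
(`M(n) + (n/2)L − M(m) − (m/2)L ≥ (n − m)((L + log n)/2 + C₁)`; error at `m` `≤ (A/c)(n − m)(L + log n)`; at `n`,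
`√n ≤ √m + (n − m)/(2√m)` gives `≤ (A/c + A/(2s₀))(n − m)(L + log n)`.)  With `L = log q` this is the Dirichlet case;
with `L = 0`, `a = λ` it is SketchG13's `li_lag_lower_bound`. -/
theorem lag_lower_bound_cond {a : ℕ → ℝ} {A c s₀ L : ℝ} (hA : 0 ≤ A) (hc : 0 < c) (hs₀ : 0 < s₀) (hL : 0 ≤ L)
    {m n : ℕ} (hm1 : 1 ≤ m) (hs : s₀ ≤ Real.sqrt m) (hlag : (m : ℝ) + c * Real.sqrt m ≤ n)
    (hm : |a m - (liMainTerm m + (m : ℝ) / 2 * L)| ≤ A * Real.sqrt m * (L + Real.log m))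
    (hn : |a n - (liMainTerm n + (n : ℝ) / 2 * L)| ≤ A * Real.sqrt n * (L + Real.log n)) :
    ((n : ℝ) - m) * ((1 / 2 - 2 * A / c - A / (2 * s₀)) * (L + Real.log n) + liC1) ≤ a n - a m := by
  have hm0 : (0 : ℝ) < m := by exact_mod_cast hm1
  have hs_pos : 0 < Real.sqrt m := Real.sqrt_pos.2 hm0
  have hcs : 0 ≤ c * Real.sqrt m := by positivity
  have hd0 : 0 ≤ (n : ℝ) - m := by linarith
  have hmn : (m : ℝ) ≤ n := by linarith
  have hn1 : (1 : ℝ) ≤ n := le_trans (by exact_mod_cast hm1) hmn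
  have hlogn0 : 0 ≤ Real.log n := Real.log_nonneg hn1
  have hΛ0 : 0 ≤ L + Real.log n := by linarith
  have hlogmn : Real.log m ≤ Real.log n := Real.log_le_log hm0 hmn
  have hΛmn : L + Real.log m ≤ L + Real.log n := by linarith
  have hd : Real.sqrt m ≤ ((n : ℝ) - m) / c := by
    rw [le_div_iff₀ hc]; linarith
  -- main term
  have hmain : ((n : ℝ) - m) * ((L + Real.log n) / 2) + liC1 * ((n : ℝ) - m) ≤
      (liMainTerm n + (n : ℝ) / 2 * L) - (liMainTerm m + (m : ℝ) / 2 * L) := by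
    have h1 : (m : ℝ) / 2 * Real.log m ≤ (m : ℝ) / 2 * Real.log n :=
      mul_le_mul_of_nonneg_left hlogmn (by positivity)
    unfold liMainTerm
    linarith
  -- error at `m`
  have herr_m : A * Real.sqrt m * (L + Real.log m) ≤ A / c * ((n : ℝ) - m) * (L + Real.log n) := by
    have h1 : A * Real.sqrt m * (L + Real.log m) ≤ A * Real.sqrt m * (L + Real.log n) :=
      mul_le_mul_of_nonneg_left hΛmn (by positivity)
    have h2 : A * Real.sqrt m * (L + Real.log n) ≤ A * (((n : ℝ) - m) / c) * (L + Real.log n) := by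
      apply mul_le_mul_of_nonneg_right _ hΛ0
      exact mul_le_mul_of_nonneg_left hd hA
    calc A * Real.sqrt m * (L + Real.log m) ≤ A * Real.sqrt m * (L + Real.log n) := h1
      _ ≤ A * (((n : ℝ) - m) / c) * (L + Real.log n) := h2
      _ = A / c * ((n : ℝ) - m) * (L + Real.log n) := by ring
  -- error at `n`
  have hsqrt_n : Real.sqrt n ≤ Real.sqrt m + ((n : ℝ) - m) / (2 * Real.sqrt m) := by
    have h := sqrt_add_le_sqrt_add_div hm0 hd0
    have e : (m : ℝ) + ((n : ℝ) - m) = n := by ring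
    rw [e] at h
    exact h
  have herr_n : A * Real.sqrt n * (L + Real.log n) ≤
      (A / c + A / (2 * s₀)) * ((n : ℝ) - m) * (L + Real.log n) := by
    have h1 : A * Real.sqrt n * (L + Real.log n) ≤
        A * (Real.sqrt m + ((n : ℝ) - m) / (2 * Real.sqrt m)) * (L + Real.log n) := by
      apply mul_le_mul_of_nonneg_right _ hΛ0
      exact mul_le_mul_of_nonneg_left hsqrt_n hA
    have h3 : ((n : ℝ) - m) / (2 * Real.sqrt m) ≤ ((n : ℝ) - m) / (2 * s₀) :=
      div_le_div_of_nonneg_left hd0 (by positivity) (by linarith)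
    have h4 : A * (Real.sqrt m + ((n : ℝ) - m) / (2 * Real.sqrt m)) * (L + Real.log n) ≤
        A * (((n : ℝ) - m) / c + ((n : ℝ) - m) / (2 * s₀)) * (L + Real.log n) := by
      apply mul_le_mul_of_nonneg_right _ hΛ0
      apply mul_le_mul_of_nonneg_left _ hA
      linarith
    calc A * Real.sqrt n * (L + Real.log n)
        ≤ A * (Real.sqrt m + ((n : ℝ) - m) / (2 * Real.sqrt m)) * (L + Real.log n) := h1
      _ ≤ A * (((n : ℝ) - m) / c + ((n : ℝ) - m) / (2 * s₀)) * (L + Real.log n) := h4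
      _ = (A / c + A / (2 * s₀)) * ((n : ℝ) - m) * (L + Real.log n) := by ring
  -- combine
  obtain ⟨hm_lo, hm_hi⟩ := abs_le.1 hm
  obtain ⟨hn_lo, hn_hi⟩ := abs_le.1 hn
  have hgoal : ((n : ℝ) - m) * ((1 / 2 - 2 * A / c - A / (2 * s₀)) * (L + Real.log n) + liC1) =
      ((n : ℝ) - m) * ((L + Real.log n) / 2) + liC1 * ((n : ℝ) - m)
        - A / c * ((n : ℝ) - m) * (L + Real.log n)
        - (A / c + A / (2 * s₀)) * ((n : ℝ) - m) * (L + Real.log n) := by ring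
  rw [hgoal]
  linarith

/-! ## §3 The Dirichlet square-root lag law -/

section Dirichlet

variable {q : ℕ} [NeZero q] {χ : DirichletCharacter ℂ q}

/-- The leaf's level law in the core's shape: `M_q(n) = M(n) + (n/2) log q` and `log(qn) = log q + log n`. -/
theorem level_law_conductor_form {a A : ℝ} {n : ℕ} (hn : 0 < n)
    (h : |a - charLiMainTerm q n| ≤ A * Real.sqrt n * Real.log (q * n)) :
    |a - (liMainTerm n + (n : ℝ) / 2 * Real.log q)| ≤ A * Real.sqrt n * (Real.log q + Real.log n) := by
  have hq0 : (q : ℝ) ≠ 0 := by exact_mod_cast NeZero.ne q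
  have hn0 : (n : ℝ) ≠ 0 := by exact_mod_cast hn.ne'
  have e : Real.log ((q : ℝ) * n) = Real.log q + Real.log n := Real.log_mul hq0 hn0
  have e' : charLiMainTerm q n = liMainTerm n + (n : ℝ) / 2 * Real.log q := rfl
  rw [← e, ← e']
  exact_mod_cast h

omit [NeZero q] in
/-- `0.6931471803 ≤ log q` for `q ≥ 2`. -/
theorem log_conductor_lower (hq : 1 < q) : (0.6931471803 : ℝ) ≤ Real.log q := by
  have h2 : (2 : ℝ) ^ 1 ≤ q := by
    rw [pow_one]; exact_mod_cast hq
  have := mul_log_two_le_log h2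
  simpa using this

/-- **GRH-FREE · AT A VERIFIED HEIGHT (tree constants).** `χ` primitive mod `q > 1`; if every zero of `L(s, χ)` with
`0 < Re ρ < 1`, `|Im ρ| ≤ T` (`T ≥ 1000`) lies on the critical line, then `λ_χ(m) < λ_χ(n)` whenever `10⁴ ≤ m` and
`m + 120√m ≤ n ≤ T²/4`.  (Two readings of `liDirichletAsymptoticLaw_proof` (constant 15); core §2 with `A = 15`,
`c = 120`, `s₀ = 100`, `L = log q ≥ log 2`: coefficient `7/40`, `log q + log n ≥ 14·log 2 > 9.70`, `C₁ ≥ −5/4`.)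
The constants do not depend on `q`. -/
theorem liChar_sqrtLag_monotone_of_rhUpTo (hχ : χ.IsPrimitive) (hq : 1 < q) {T : ℝ} (hT : 1000 ≤ T)
    (hRH : LFunctionRHUpTo χ T) {m n : ℕ} (hm : 10000 ≤ m) (hlag : (m : ℝ) + 120 * Real.sqrt m ≤ n)
    (hnT : (n : ℝ) ≤ 1 / 4 * T ^ 2) :
    LiDirichlet.liCoeffCharRe χ m < LiDirichlet.liCoeffCharRe χ n := by
  have hm1 : 1 ≤ m := le_trans (by norm_num) hm
  have hmR : (10000 : ℝ) ≤ m := by exact_mod_cast hm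
  have hs : (100 : ℝ) ≤ Real.sqrt m := le_sqrt_of_sq_le (by norm_num) (by nlinarith)
  have hmn : (m : ℝ) ≤ n := by linarith
  have hnN : 10000 ≤ n := by exact_mod_cast hmR.trans hmn
  have hn0 : 0 < n := lt_of_lt_of_le (by norm_num) hnN
  have hmT : (m : ℝ) ≤ 1 / 4 * T ^ 2 := hmn.trans hnT
  have hL : 0 ≤ Real.log q := Real.log_nonneg (by exact_mod_cast hq.le)
  have hbm := level_law_conductor_form (lt_of_lt_of_le (by norm_num) hm)
    ((liDirichletAsymptoticLaw_proof q χ hχ hq hT hRH hmT).1 hm)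
  have hbn := level_law_conductor_form hn0 ((liDirichletAsymptoticLaw_proof q χ hχ hq hT hRH hnT).1 hnN)
  have key := lag_lower_bound_cond (a := LiDirichlet.liCoeffCharRe χ) (A := 15) (c := 120) (s₀ := 100)
    (L := Real.log q) (by norm_num) (by norm_num) (by norm_num) hL hm1 hs hlag hbm hbn
  have h2 : (2 : ℝ) ^ 13 ≤ n := le_trans (by norm_num) (hmR.trans hmn)
  have hlog := mul_log_two_le_log h2
  push_cast at hlog
  have hlq := log_conductor_lower hq
  have hC1 := neg_five_fourths_le_liC1
  have hcoef : (2 / 5 : ℝ) ≤ (1 / 2 - 2 * 15 / 120 - 15 / (2 * 100)) * (Real.log q + Real.log n) + liC1 := by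
    norm_num at hlog ⊢
    linarith
  have hd : (12000 : ℝ) ≤ (n : ℝ) - m := by linarith
  nlinarith [mul_le_mul hd hcoef (by norm_num) (by linarith)]

/-- **GRH-FREE · AT A VERIFIED HEIGHT, BMOR form (the Riemann–von Mangoldt formula for `N(T, χ)` of Bennett–Martin–
O'Bryant–Rechnitzer 2021 Thm 1.1 carried as the hypothesis `bmor2021_theorem11`, never asserted).**  Then the level
law has constant `1` from `n ≥ 900`, and `λ_χ(m) < λ_χ(n)` whenever `900 ≤ m`, `m + 7√m ≤ n ≤ T²/4`
(core §2 with `A = 1`, `c = 7`, `s₀ = 30`: coefficient `83/420`, `log q + log n ≥ 10·log 2 > 6.93`). -/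
theorem liChar_sqrtLag_monotone_of_rhUpTo_bmor (hB : bmor2021_theorem11) (hχ : χ.IsPrimitive) (hq : 1 < q)
    {T : ℝ} (hT : 1000 ≤ T) (hRH : LFunctionRHUpTo χ T) {m n : ℕ} (hm : 900 ≤ m)
    (hlag : (m : ℝ) + 7 * Real.sqrt m ≤ n) (hnT : (n : ℝ) ≤ 1 / 4 * T ^ 2) :
    LiDirichlet.liCoeffCharRe χ m < LiDirichlet.liCoeffCharRe χ n := by
  have hm1 : 1 ≤ m := le_trans (by norm_num) hm
  have hmR : (900 : ℝ) ≤ m := by exact_mod_cast hm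
  have hs : (30 : ℝ) ≤ Real.sqrt m := le_sqrt_of_sq_le (by norm_num) (by nlinarith)
  have hmn : (m : ℝ) ≤ n := by linarith
  have hnN : 900 ≤ n := by exact_mod_cast hmR.trans hmn
  have hn0 : 0 < n := lt_of_lt_of_le (by norm_num) hnN
  have hmT : (m : ℝ) ≤ 1 / 4 * T ^ 2 := hmn.trans hnT
  have hL : 0 ≤ Real.log q := Real.log_nonneg (by exact_mod_cast hq.le)
  have hbm := level_law_conductor_form (A := 1) (lt_of_lt_of_le (by norm_num) hm)
    (by simpa using (liDirichletAsymptoticLaw_proof q χ hχ hq hT hRH hmT).2 hB hm)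
  have hbn := level_law_conductor_form (A := 1) hn0
    (by simpa using (liDirichletAsymptoticLaw_proof q χ hχ hq hT hRH hnT).2 hB hnN)
  have key := lag_lower_bound_cond (a := LiDirichlet.liCoeffCharRe χ) (A := 1) (c := 7) (s₀ := 30)
    (L := Real.log q) (by norm_num) (by norm_num) (by norm_num) hL hm1 hs hlag hbm hbn
  have h2 : (2 : ℝ) ^ 9 ≤ n := le_trans (by norm_num) (hmR.trans hmn)
  have hlog := mul_log_two_le_log h2
  push_cast at hlog
  have hlq := log_conductor_lower hq
  have hC1 := neg_five_fourths_le_liC1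
  have hcoef : (1 / 10 : ℝ) ≤ (1 / 2 - 2 * 1 / 7 - 1 / (2 * 30)) * (Real.log q + Real.log n) + liC1 := by
    norm_num at hlog ⊢
    linarith
  have hd : (210 : ℝ) ≤ (n : ℝ) - m := by linarith
  nlinarith [mul_le_mul hd hcoef (by norm_num) (by linarith)]

/-- **ON PLATT'S FACT (Platt 2016 Thm 7.1: GRH for `χ` mod `q ≤ 4·10⁵` to height `10⁸/q`, carried as the hypothesis
`platt2016_theorem71`) AND BMOR Thm 1.1:** for `χ` primitive mod `1 < q ≤ 10⁵` (so `10⁸/q ≥ 1000`),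
`λ_χ(m) < λ_χ(n)` whenever `900 ≤ m` and `m + 7√m ≤ n ≤ ¼(10⁸/q)²`.  RH/GRH-FREE implication from two cited facts. -/
theorem liChar_sqrtLag_monotone_platt (hP : platt2016_theorem71) (hB : bmor2021_theorem11) (hχ : χ.IsPrimitive)
    (hq : 1 < q) (hq5 : q ≤ 100000) {m n : ℕ} (hm : 900 ≤ m) (hlag : (m : ℝ) + 7 * Real.sqrt m ≤ n)
    (hnT : (n : ℝ) ≤ 1 / 4 * (10 ^ 8 / (q : ℝ)) ^ 2) :
    LiDirichlet.liCoeffCharRe χ m < LiDirichlet.liCoeffCharRe χ n := by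
  have hχ1 : χ ≠ 1 := ne_one_of_isPrimitive hχ hq
  have hq0 : (0 : ℝ) < q := by exact_mod_cast lt_trans zero_lt_one hq
  have hq5' : (q : ℝ) ≤ 100000 := by exact_mod_cast hq5
  have hT : (1000 : ℝ) ≤ 10 ^ 8 / (q : ℝ) := by
    rw [le_div_iff₀ hq0]; nlinarith
  have hRH : LFunctionRHUpTo χ (10 ^ 8 / (q : ℝ)) :=
    grhUpTo_of_platt2016 hP (le_trans hq5 (by norm_num)) χ hχ1
  exact liChar_sqrtLag_monotone_of_rhUpTo_bmor hB hχ hq hT hRH hm hlag hnT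

/-- `n ≤ ¼ (max 1000 (2√n))²`. -/
theorem le_quarter_sq_height (n : ℕ) : (n : ℝ) ≤ 1 / 4 * (max 1000 (2 * Real.sqrt n)) ^ 2 := by
  have h1 : 2 * Real.sqrt n ≤ max 1000 (2 * Real.sqrt n) := le_max_right _ _
  have h2 : (2 * Real.sqrt n) ^ 2 = 4 * n := by
    rw [mul_pow, Real.sq_sqrt (Nat.cast_nonneg n)]; norm_num
  have h3 : (2 * Real.sqrt n) ^ 2 ≤ (max 1000 (2 * Real.sqrt n)) ^ 2 :=
    pow_le_pow_left₀ (by positivity) h1 2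
  linarith

/-- **GRH-CONSEQUENCE · EFFECTIVE · UNIFORM IN THE CONDUCTOR: THE DIRICHLET SQUARE-ROOT LAG LAW.**  For `χ` primitive
mod `q > 1`, `GRH(χ)` (`χ.RiemannHypothesis`, strip form) gives `λ_χ(m) < λ_χ(n)` whenever `m ≥ 10⁴` and
`n ≥ m + 120√m` — the same `m₀ = 10⁴` and lag constant `120` for EVERY conductor. -/
theorem liChar_sqrtLag_monotone_of_grh (hχ : χ.IsPrimitive) (hq : 1 < q) (hGRH : χ.RiemannHypothesis)
    {m n : ℕ} (hm : 10000 ≤ m) (hlag : (m : ℝ) + 120 * Real.sqrt m ≤ n) :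
    LiDirichlet.liCoeffCharRe χ m < LiDirichlet.liCoeffCharRe χ n :=
  liChar_sqrtLag_monotone_of_rhUpTo hχ hq (le_max_left _ _)
    (LFunctionRHUpTo.of_riemannHypothesis hGRH (max 1000 (2 * Real.sqrt n))) hm hlag (le_quarter_sq_height n)

/-- **GRH-CONSEQUENCE, BMOR form:** given BMOR Thm 1.1, `GRH(χ)` gives `λ_χ(m) < λ_χ(n)` for `m ≥ 900`, `n ≥ m + 7√m`
(uniformly in `q`). -/
theorem liChar_sqrtLag_monotone_of_grh_bmor (hB : bmor2021_theorem11) (hχ : χ.IsPrimitive) (hq : 1 < q)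
    (hGRH : χ.RiemannHypothesis) {m n : ℕ} (hm : 900 ≤ m) (hlag : (m : ℝ) + 7 * Real.sqrt m ≤ n) :
    LiDirichlet.liCoeffCharRe χ m < LiDirichlet.liCoeffCharRe χ n :=
  liChar_sqrtLag_monotone_of_rhUpTo_bmor hB hχ hq (le_max_left _ _)
    (LFunctionRHUpTo.of_riemannHypothesis hGRH (max 1000 (2 * Real.sqrt n))) hm hlag (le_quarter_sq_height n)

end Dirichlet

/-- **THE CONSTANT, UNIFORMLY IN THE CONDUCTOR (GRH-FREE): an `A√n·log(qn)` level law beyond `n₀` gives the lag law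
at every `c > 4A`, with `m₀ = m₀(A, c, n₀)` chosen BEFORE `q` and `χ`.**  Core §2 with `s₀ = A/κ₀`,
`κ₀ = 1/2 − 2A/c > 0`, `L = log q ≥ 0`, and `m₀` so large that `√m₀ ≥ s₀` and `(κ₀/2) log m₀ ≥ 3/2`. -/
theorem liChar_lag_monotone_of_level_law {A : ℝ} {n₀ : ℕ} (hA : 0 < A) {c : ℝ} (hc : 4 * A < c) :
    ∃ m₀ : ℕ, ∀ (q : ℕ) [NeZero q] (χ : DirichletCharacter ℂ q),
      (∀ n : ℕ, n₀ ≤ n →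
        |LiDirichlet.liCoeffCharRe χ n - charLiMainTerm q n| ≤ A * Real.sqrt n * Real.log (q * n)) →
      ∀ m : ℕ, m₀ ≤ m → ∀ n : ℕ, (m : ℝ) + c * Real.sqrt m ≤ n →
        LiDirichlet.liCoeffCharRe χ m < LiDirichlet.liCoeffCharRe χ n := by
  have hc0 : 0 < c := by linarith
  set κ₀ : ℝ := 1 / 2 - 2 * A / c with hκ₀
  have hκ : 0 < κ₀ := by
    rw [hκ₀, sub_pos, div_lt_iff₀ hc0]; linarith
  set s₀ : ℝ := A / κ₀ with hs₀def
  have hs₀ : 0 < s₀ := by positivity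
  obtain ⟨M₁, hM₁⟩ := exists_nat_ge (s₀ ^ 2)
  obtain ⟨M₂, hM₂⟩ := exists_nat_ge (Real.exp (3 / κ₀))
  refine ⟨max (max n₀ 1) (max M₁ M₂), fun q _ χ hlaw m hm n hmn ↦ ?_⟩
  have hmn₀ : n₀ ≤ m := le_trans (le_max_left _ _) (le_of_max_le_left hm)
  have hm1 : 1 ≤ m := le_trans (le_max_right _ _) (le_of_max_le_left hm)
  have hmM₁ : (M₁ : ℝ) ≤ m := by exact_mod_cast le_trans (le_max_left _ _) (le_of_max_le_right hm)
  have hmM₂ : (M₂ : ℝ) ≤ m := by exact_mod_cast le_trans (le_max_right _ _) (le_of_max_le_right hm)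
  have hm0 : (0 : ℝ) < m := by exact_mod_cast hm1
  have hs : s₀ ≤ Real.sqrt m := le_sqrt_of_sq_le hs₀.le (hM₁.trans hmM₁)
  have hmn' : (m : ℝ) ≤ n := by nlinarith [Real.sqrt_nonneg (m : ℝ)]
  have hnn₀ : n₀ ≤ n := by exact_mod_cast (show (n₀ : ℝ) ≤ n from (Nat.cast_le.2 hmn₀).trans hmn')
  have hn0 : 0 < n := lt_of_lt_of_le (lt_of_lt_of_le zero_lt_one hm1) (by exact_mod_cast hmn')
  have hq1 : 1 ≤ q := Nat.one_le_iff_ne_zero.2 (NeZero.ne q)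
  have hL : 0 ≤ Real.log q := Real.log_nonneg (by exact_mod_cast hq1)
  have hbm := level_law_conductor_form (lt_of_lt_of_le zero_lt_one hm1) (hlaw m hmn₀)
  have hbn := level_law_conductor_form hn0 (hlaw n hnn₀)
  have key := lag_lower_bound_cond (a := LiDirichlet.liCoeffCharRe χ) hA.le hc0 hs₀ hL hm1 hs hmn hbm hbn
  have hcoefeq : 1 / 2 - 2 * A / c - A / (2 * s₀) = κ₀ / 2 := by
    rw [hs₀def]
    field_simp
    rw [hκ₀]
    field_simp
    ring
  rw [hcoefeq] at key
  have hexp : Real.exp (3 / κ₀) ≤ n := (hM₂.trans hmM₂).trans hmn'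
  have hlog : 3 / κ₀ ≤ Real.log n := by
    rw [Real.le_log_iff_exp_le (lt_of_lt_of_le (Real.exp_pos _) hexp)]; exact hexp
  have hlogn0 : 0 ≤ Real.log n := le_trans (by positivity) hlog
  have hC1 := neg_five_fourths_le_liC1
  have hcoef : (1 / 4 : ℝ) ≤ κ₀ / 2 * (Real.log q + Real.log n) + liC1 := by
    have h3 : (3 : ℝ) ≤ κ₀ * Real.log n := by
      have := mul_le_mul_of_nonneg_left hlog hκ.le
      rwa [mul_div_cancel₀ _ hκ.ne'] at this
    have h4 : 0 ≤ κ₀ * Real.log q := by positivity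
    nlinarith
  have hd : c * s₀ ≤ (n : ℝ) - m := by nlinarith [mul_le_mul_of_nonneg_left hs hc0.le]
  have hcs : 0 < c * s₀ := by positivity
  nlinarith [mul_le_mul hd hcoef (by norm_num) (by linarith)]

/-- **COROLLARY (GRH-CONSEQUENCE, every lag `c > 60`, uniformly in `q`):** one `m₀ = m₀(c)` such that for EVERY
primitive `χ` mod `q > 1` satisfying `GRH(χ)`, `λ_χ(m) < λ_χ(n)` whenever `m ≥ m₀`, `n ≥ m + c√m`. -/
theorem liChar_lag_monotone_of_grh_every_c {c : ℝ} (hc : 60 < c) :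
    ∃ m₀ : ℕ, ∀ (q : ℕ) [NeZero q] (χ : DirichletCharacter ℂ q), χ.IsPrimitive → 1 < q → χ.RiemannHypothesis →
      ∀ m : ℕ, m₀ ≤ m → ∀ n : ℕ, (m : ℝ) + c * Real.sqrt m ≤ n →
        LiDirichlet.liCoeffCharRe χ m < LiDirichlet.liCoeffCharRe χ n := by
  obtain ⟨m₀, hm₀⟩ := liChar_lag_monotone_of_level_law (A := 15) (n₀ := 10000) (by norm_num) (c := c) (by linarith)
  refine ⟨m₀, fun q _ χ hχ hq hGRH m hm n hmn ↦ hm₀ q χ (fun k hk ↦ ?_) m hm n hmn⟩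
  exact (liDirichletAsymptoticLaw_proof q χ hχ hq (le_max_left 1000 (2 * Real.sqrt k))
    (LFunctionRHUpTo.of_riemannHypothesis hGRH _) (le_quarter_sq_height k)).1 hk

end Summit.RiemannHypothesis.RiemannHypothesis.Theorems.Splittings.LiDirichletSqrtLagLaw
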